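import Summits.ValiantsHypothesis.ValiantsHypothesis.Theorems.KPlusLogSqLawTropicalExchange

/-!
# Route «KPlusLogSqLaw», cruxes `WeakLifting` / `TropicalB` — structure lemma: LEX TOP-CLASS RIGIDITY (three-term law)

HONEST FRAMING.  Helper file (cell `pub-symmetroid`, seat val-sym-lift-p3 g4, 2026-08-27) toward the crux
`Summit.ValiantsHypothesis.ValiantsHypothesis.Theses.KPlusLogSqLaw.WeakLifting` (ledger item `stmt-ValiantsHypothesis-19561`;
docket D2 = the `K = 4` tropical exponent fork), in the dominance vocabulary of `…CensusTropicalKLaw` / `…TropicalExchange`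
(`IsDominant`, `slope`, columnwise re-decompositions).  A STRUCTURAL law for dominant terms of an ARBITRARY design in the LEX regime of
one class; it proves no stub and asserts nothing about `TropicalB`, `WeakLifting`, `Lifting`, `KPlusLogSqLaw`, `MatrixDescartes`
(stmt-ValiantsHypothesis-18050) or `VP ≠ VNP`.

THE LAW (`classCount_eq_of_redecomp_three`).  Fix a class `l⋆` whose exponent dominates: `d l⋆ ≥ m · D` where `D` bounds every other
exponent (the top class of a lex design).  Let `t₀, t₁, t₂` be unique optima at slopes `θ₀ < θ₁ < θ₂` carrying the SAME number `c` of
`l⋆`-entries (three terms of one «page» of the chain), and let `u₀, u₁, u₂` be ANY columnwise re-decomposition of them (in every column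
the three (row, class) data of the `u`'s are those of the `t`'s, permuted).  Then every `u_r` carries exactly `c` entries of class `l⋆`.
So inside a page the top class cannot be CONCENTRATED by recombination: «pages are rigid».  (The cell's pairwise laws — cyclewise
monotonicity `sum_d_lt_of_isDominant_invariant`, the exchange lemma `slope_lt_of_resplit` — are the two-term case, where a
re-decomposition is a union of flipped cycles; the three-term case is the first that recombines entries of different terms in one
column pattern, and it is what forces, for strongly lex designs, the top class of a page onto DEDICATED LINES — evidence memo
`K4-PAGE-RIGIDITY-AND-CARRIES.md` of this seat.)

PROOF.  If some `u_r` had an `l⋆`-count `≠ c`, the three excesses `e_r = count_r − c` sum to `0` (columnwise multisets agree) and are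
not all `0`, so `min e ≤ −1` and `max e ≥ 1`.  Re-index the `u`'s so that the minimal excess sits at `θ₀` and the maximal at `θ₂`
(re-indexing preserves the columnwise multisets).  Writing `slope = d l⋆ · count + rest` with `0 ≤ rest ≤ m·D`, Abel summation gives
`Σ θ_r slope u_r − Σ θ_r slope t_r ≥ (θ₂ − θ₀)(d l⋆ − m·D) ≥ 0`, contradicting the tree's k-fold EXCHANGE / MAJORIZATION lemma
`sum_mul_slope_lt_of_redecomp` (`Σ θ_r slope u_r < Σ θ_r slope t_r` for every nontrivial re-decomposition of dominant terms).
[folklore LP-duality reasoning for the assignment polytope; this packaging is the cell's]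
-/

set_option linter.dupNamespace false
set_option autoImplicit false

namespace Summit.ValiantsHypothesis.ValiantsHypothesis.Theorems.LacunarySymmetroidMatrixDescartes.TropicalCensus

open Summit.ValiantsHypothesis.ValiantsHypothesis.Theorems.MatrixDescartes.Negative
open scoped BigOperators
open Finset

section PageRigidity

variable {m K : ℕ}

/-- slope = (top exponent)·(top count) + rest, with `0 ≤ rest ≤ m·D` when every other exponent is `≤ D`. [folklore] -/
theorem pageRigid_slope_eq_count_add_rest (d : Fin K → ℕ) (lstar : Fin K) (p : Equiv.Perm (Fin m) × (Fin m → Fin K)) :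
    slope d p = (d lstar : ℤ) * ((univ.filter fun i => p.2 i = lstar).card : ℤ)
      + ∑ i ∈ univ.filter (fun i => ¬ p.2 i = lstar), (d (p.2 i) : ℤ) := by
  unfold slope
  rw [← sum_filter_add_sum_filter_not univ (fun i => p.2 i = lstar)]
  congr 1
  rw [sum_congr rfl (fun i hi => by rw [(mem_filter.mp hi).2] : ∀ i ∈ univ.filter (fun i => p.2 i = lstar),
    (d (p.2 i) : ℤ) = (d lstar : ℤ)), sum_const, nsmul_eq_mul, mul_comm]

/-- the non-top part of a slope is nonnegative. [folklore] -/
theorem pageRigid_rest_nonneg (d : Fin K → ℕ) (lstar : Fin K) (p : Equiv.Perm (Fin m) × (Fin m → Fin K)) :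
    0 ≤ ∑ i ∈ univ.filter (fun i => ¬ p.2 i = lstar), (d (p.2 i) : ℤ) :=
  sum_nonneg fun i _ => by positivity

/-- the non-top part of a slope is at most `m·D` when every other exponent is `≤ D`. [folklore] -/
theorem pageRigid_rest_le (d : Fin K → ℕ) (lstar : Fin K) (D : ℕ) (hD : ∀ l, l ≠ lstar → d l ≤ D)
    (p : Equiv.Perm (Fin m) × (Fin m → Fin K)) :
    ∑ i ∈ univ.filter (fun i => ¬ p.2 i = lstar), (d (p.2 i) : ℤ) ≤ (m : ℤ) * D := by
  calc ∑ i ∈ univ.filter (fun i => ¬ p.2 i = lstar), (d (p.2 i) : ℤ)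
      ≤ ∑ _i ∈ univ.filter (fun i => ¬ p.2 i = lstar), (D : ℤ) := by
        refine sum_le_sum fun i hi => ?_
        exact_mod_cast hD _ (mem_filter.mp hi).2
    _ = ((univ.filter (fun i => ¬ p.2 i = lstar)).card : ℤ) * D := by rw [sum_const, nsmul_eq_mul]
    _ ≤ (m : ℤ) * D := by
        refine mul_le_mul_of_nonneg_right ?_ (by positivity)
        exact_mod_cast (card_filter_le _ _).trans (by simp)

/-- columnwise multisets are invariant under re-indexing the family by a permutation of the index set. [folklore] -/
theorem pageRigid_colMultiset_comp_equiv {k : ℕ} (u : Fin k → Equiv.Perm (Fin m) × (Fin m → Fin K)) (π : Equiv.Perm (Fin k))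
    (i : Fin m) :
    (univ : Finset (Fin k)).val.map (fun r => ((u (π r)).1 i, (u (π r)).2 i)) =
      (univ : Finset (Fin k)).val.map (fun r => ((u r).1 i, (u r).2 i)) := by
  have h : (univ : Finset (Fin k)).val.map (fun r => ((u (π r)).1 i, (u (π r)).2 i))
      = ((univ : Finset (Fin k)).val.map π).map (fun r => ((u r).1 i, (u r).2 i)) := by
    rw [Multiset.map_map]; rfl
  rw [h]
  congr 1
  have h2 := congrArg Finset.val (Finset.map_univ_equiv π)
  rw [Finset.map_val] at h2
  exact h2

/-- a columnwise sum over a re-decomposition equals that over the original family (tree lemma, two-argument form). -/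
theorem pageRigid_sum_colfun_eq_of_redecomp {k : ℕ} (t u : Fin k → Equiv.Perm (Fin m) × (Fin m → Fin K))
    (hcol : ∀ i : Fin m, (univ : Finset (Fin k)).val.map (fun r => ((u r).1 i, (u r).2 i)) =
      (univ : Finset (Fin k)).val.map (fun r => ((t r).1 i, (t r).2 i)))
    (g : Fin m → Fin K → ℤ) :
    ∑ r, ∑ i, g i ((u r).2 i) = ∑ r, ∑ i, g i ((t r).2 i) := by
  rw [sum_comm, sum_comm (f := fun r i => g i ((t r).2 i))]
  exact sum_congr rfl fun i _ => sum_col_eq_of_redecomp t u hcol (fun i _ l => g i l) i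

/-- the `l⋆`-count as an integer columnwise sum. -/
theorem pageRigid_count_eq_sum_ite (lstar : Fin K) (p : Equiv.Perm (Fin m) × (Fin m → Fin K)) :
    ((univ.filter fun i => p.2 i = lstar).card : ℤ) = ∑ i, (if p.2 i = lstar then (1 : ℤ) else 0) := by
  rw [sum_ite, sum_const_zero, add_zero, sum_const, nsmul_eq_mul, mul_one]

/-- **LEX TOP-CLASS RIGIDITY (three-term law).**  If the exponent of the class `l⋆` is at least `m` times every other exponent,
three dominant terms at strictly increasing slopes with the same `l⋆`-count `c` admit no columnwise re-decomposition in which some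
term has an `l⋆`-count different from `c`. [folklore] -/
theorem classCount_eq_of_redecomp_three (d : Fin K → ℕ) (v ε : Fin m → Fin m → Fin K → ℤ)
    (θ : Fin 3 → ℤ) (hθ : StrictMono θ) (t u : Fin 3 → Equiv.Perm (Fin m) × (Fin m → Fin K))
    (hdom : ∀ r, IsDominant d v ε (θ r) (t r))
    (hcol : ∀ i : Fin m, (univ : Finset (Fin 3)).val.map (fun r => ((u r).1 i, (u r).2 i)) =
      (univ : Finset (Fin 3)).val.map (fun r => ((t r).1 i, (t r).2 i)))
    (lstar : Fin K) (D : ℕ) (hD : ∀ l, l ≠ lstar → d l ≤ D) (hlex : m * D ≤ d lstar)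
    (c : ℕ) (hc : ∀ r, (univ.filter fun i => (t r).2 i = lstar).card = c) :
    ∀ r, (univ.filter fun i => (u r).2 i = lstar).card = c := by
  classical
  -- integer excesses
  set cnt : (Equiv.Perm (Fin m) × (Fin m → Fin K)) → ℤ := fun p => ((univ.filter fun i => p.2 i = lstar).card : ℤ)
    with hcnt
  by_contra hne
  push Not at hne
  obtain ⟨r₀, hr₀⟩ := hne
  -- total counts agree
  have htot : ∑ r, cnt (u r) = ∑ r, cnt (t r) := by
    simp only [hcnt, pageRigid_count_eq_sum_ite]
    exact pageRigid_sum_colfun_eq_of_redecomp t u hcol (fun _ l => if l = lstar then 1 else 0)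
  have htotc : ∑ r, cnt (t r) = 3 * (c : ℤ) := by
    simp only [hcnt, hc, sum_const, card_univ, Fintype.card_fin, nsmul_eq_mul]
    norm_num
  -- min and max excess indices
  obtain ⟨rmin, -, hmin⟩ := exists_min_image (univ : Finset (Fin 3)) (fun r => cnt (u r)) univ_nonempty
  obtain ⟨rmax, -, hmax⟩ := exists_max_image (univ : Finset (Fin 3)) (fun r => cnt (u r)) univ_nonempty
  have hc3 : ∑ _r : Fin 3, (c : ℤ) = 3 * (c : ℤ) := by
    simp only [sum_const, card_univ, Fintype.card_fin, nsmul_eq_mul]; norm_num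
  have hr₀' : cnt (u r₀) ≠ c := by
    simp only [hcnt]; exact_mod_cast hr₀
  have hlo : cnt (u rmin) ≤ (c : ℤ) - 1 := by
    by_contra h
    push Not at h
    have hnn : ∀ r ∈ (univ : Finset (Fin 3)), 0 ≤ cnt (u r) - c := by
      intro r _; have := hmin r (mem_univ _); omega
    have hs0 : ∑ r, (cnt (u r) - (c : ℤ)) = 0 := by
      rw [sum_sub_distrib, htot, htotc, hc3]; ring
    have := (sum_eq_zero_iff_of_nonneg hnn).mp hs0 r₀ (mem_univ _)
    exact hr₀' (by omega)
  have hhi : (c : ℤ) + 1 ≤ cnt (u rmax) := by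
    by_contra h
    push Not at h
    have hnn : ∀ r ∈ (univ : Finset (Fin 3)), 0 ≤ (c : ℤ) - cnt (u r) := by
      intro r _; have := hmax r (mem_univ _); omega
    have hs0 : ∑ r, ((c : ℤ) - cnt (u r)) = 0 := by
      rw [sum_sub_distrib, htot, htotc, hc3]; ring
    have := (sum_eq_zero_iff_of_nonneg hnn).mp hs0 r₀ (mem_univ _)
    exact hr₀' (by omega)
  have hminmax : rmin ≠ rmax := by intro h; rw [h] at hlo; omega
  -- the third index
  obtain ⟨rmid, hmid1, hmid2⟩ : ∃ r : Fin 3, r ≠ rmin ∧ r ≠ rmax := by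
    have : ∀ a b : Fin 3, ∃ r : Fin 3, r ≠ a ∧ r ≠ b := by decide
    exact this rmin rmax
  -- the re-indexing permutation π : 0 ↦ rmin, 1 ↦ rmid, 2 ↦ rmax
  let f : Fin 3 → Fin 3 := ![rmin, rmid, rmax]
  have hfinj : Function.Injective f := by
    intro a b hab
    fin_cases a <;> fin_cases b <;> simp [f] at hab ⊢ <;> first
      | exact absurd hab hmid1.symm | exact absurd hab hminmax | exact absurd hab hmid1
      | exact absurd hab hmid2 | exact absurd hab hminmax.symm | exact absurd hab hmid2.symm
  let π : Equiv.Perm (Fin 3) := Equiv.ofBijective f (Finite.injective_iff_bijective.mp hfinj)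
  have hπ0 : π 0 = rmin := rfl
  have hπ1 : π 1 = rmid := rfl
  have hπ2 : π 2 = rmax := rfl
  let u' : Fin 3 → Equiv.Perm (Fin m) × (Fin m → Fin K) := fun r => u (π r)
  have hcol' : ∀ i : Fin m, (univ : Finset (Fin 3)).val.map (fun r => ((u' r).1 i, (u' r).2 i)) =
      (univ : Finset (Fin 3)).val.map (fun r => ((t r).1 i, (t r).2 i)) := by
    intro i; rw [← hcol i]; exact pageRigid_colMultiset_comp_equiv u π i
  have hne' : u' ≠ t := by
    intro h
    have : cnt (u' 0) = cnt (t 0) := by rw [h]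
    simp only [u', hπ0] at this
    rw [show cnt (t 0) = c from by simp only [hcnt, hc]] at this
    omega
  -- the exchange lemma
  have hlt := sum_mul_slope_lt_of_redecomp d v ε θ t u' hdom hcol' hne'
  -- slopes split as top + rest
  set E : ℤ := (d lstar : ℤ) with hE
  set rest : (Equiv.Perm (Fin m) × (Fin m → Fin K)) → ℤ :=
    fun p => ∑ i ∈ univ.filter (fun i => ¬ p.2 i = lstar), (d (p.2 i) : ℤ) with hrest
  have hsl : ∀ p : Equiv.Perm (Fin m) × (Fin m → Fin K), slope d p = E * cnt p + rest p :=
    fun p => pageRigid_slope_eq_count_add_rest d lstar p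
  have hr0 : ∀ p : Equiv.Perm (Fin m) × (Fin m → Fin K), 0 ≤ rest p := fun p => pageRigid_rest_nonneg d lstar p
  have hr1 : ∀ p : Equiv.Perm (Fin m) × (Fin m → Fin K), rest p ≤ (m : ℤ) * D := fun p => pageRigid_rest_le d lstar D hD p
  -- total slopes agree, hence total rests agree
  have hslopetot : ∑ r, slope d (u' r) = ∑ r, slope d (t r) := by
    unfold slope
    exact pageRigid_sum_colfun_eq_of_redecomp t u' hcol' (fun _ l => (d l : ℤ))
  have hcnttot : ∑ r, cnt (u' r) = 3 * (c : ℤ) := by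
    rw [← htotc, ← htot]
    simp only [u']
    exact Equiv.sum_comp π (fun r => cnt (u r))
  -- expand the three-term sums
  simp only [Fin.sum_univ_three] at hlt hslopetot hcnttot
  rw [hsl, hsl, hsl, hsl, hsl, hsl] at hlt
  rw [hsl, hsl, hsl, hsl, hsl, hsl] at hslopetot
  have hθ01 : θ 0 < θ 1 := hθ (by decide)
  have hθ12 : θ 1 < θ 2 := hθ (by decide)
  have hc0 : cnt (t 0) = c := by simp only [hcnt, hc]
  have hc1 : cnt (t 1) = c := by simp only [hcnt, hc]
  have hc2 : cnt (t 2) = c := by simp only [hcnt, hc]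
  rw [hc0, hc1, hc2] at hlt hslopetot
  have hu0 : cnt (u' 0) ≤ (c : ℤ) - 1 := by simp only [u', hπ0]; exact hlo
  have hu2 : (c : ℤ) + 1 ≤ cnt (u' 2) := by simp only [u', hπ2]; exact hhi
  have hElex : (m : ℤ) * D ≤ E := by rw [hE]; exact_mod_cast hlex
  have hE0 : 0 ≤ E := by rw [hE]; positivity
  have hA : 0 ≤ θ 1 - θ 0 := by linarith
  have hB : 0 ≤ θ 2 - θ 1 := by linarith
  -- eliminate the middle term: counts and rests of index 1
  have hrests : rest (u' 0) + rest (u' 1) + rest (u' 2) = rest (t 0) + rest (t 1) + rest (t 2) := by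
    have hm : E * (cnt (u' 0) + cnt (u' 1) + cnt (u' 2)) = E * (3 * (c : ℤ)) := by rw [hcnttot]
    linarith
  have hP1 : 0 ≤ E * ((θ 1 - θ 0) * ((c : ℤ) - 1 - cnt (u' 0))) :=
    mul_nonneg hE0 (mul_nonneg hA (by linarith))
  have hP2 : 0 ≤ E * ((θ 2 - θ 1) * (cnt (u' 2) - ((c : ℤ) + 1))) :=
    mul_nonneg hE0 (mul_nonneg hB (by linarith))
  have hP3 : 0 ≤ (θ 1 - θ 0) * ((m : ℤ) * D - rest (u' 0) + rest (t 0)) :=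
    mul_nonneg hA (by linarith [hr1 (u' 0), hr0 (t 0)])
  have hP4 : 0 ≤ (θ 2 - θ 1) * ((m : ℤ) * D + rest (u' 2) - rest (t 2)) :=
    mul_nonneg hB (by linarith [hr0 (u' 2), hr1 (t 2)])
  have hP5 : 0 ≤ (θ 1 - θ 0) * (E - (m : ℤ) * D) := mul_nonneg hA (by linarith)
  have hP6 : 0 ≤ (θ 2 - θ 1) * (E - (m : ℤ) * D) := mul_nonneg hB (by linarith)
  -- multiplied forms of the two conservation laws (so that the middle index can be eliminated linearly)
  have hM1 : θ 1 * E * (cnt (u' 0) + cnt (u' 1) + cnt (u' 2)) = θ 1 * E * (3 * (c : ℤ)) := by rw [hcnttot]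
  have hM2 : θ 1 * (rest (u' 0) + rest (u' 1) + rest (u' 2)) = θ 1 * (rest (t 0) + rest (t 1) + rest (t 2)) := by
    rw [hrests]
  linarith [hP1, hP2, hP3, hP4, hP5, hP6, hM1, hM2, hlt]

end PageRigidity

end Summit.ValiantsHypothesis.ValiantsHypothesis.Theorems.LacunarySymmetroidMatrixDescartes.TropicalCensus
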